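import Literature.AlgebraicGeometry.HodgeTheory.BettiHodgeConjectureProductsMiddlePieceHomBound
import HarnessLib

/-!
# `HC(Y × X)` for an arbitrary `Y` and an off-middle-algebraic `X`: for `dim X` odd it takes `Hdg(H^{odd}Y ⊗ HⁿX) = 0`, for `dim X = 2h` even it takes «no exceptional Hodge class on
# `H^{2a}Y ⊗ HⁿX`» (`dim Hom_HS(H^{2a}Y, HⁿX(h−a)) ≤ ρₐ(Y)ρ_h(X)`); curves, surfaces and threefolds times smooth hypersurfaces
# (Voisin I §11.3.3 Thm. 11.38–11.40, Lemma 11.41, p. 287; Voisin II §1.2.3 Cor. 1.24–1.25, §9.2.4 Prop. 9.20)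

Family `hodge`, lane `lit-hodgefound` (Track 2 foundations library; Layers A1/A4), layer `Literature/AlgebraicGeometry/HodgeTheory`.  THEOREMS ONLY (no definition, no named fact, no instance;
D-0026 net debt `0`).  Sequel of the seat's g29-#7 (`BettiHodgeConjectureProductsOffMiddleAlgebraicFactor`: with `X` off-middle algebraic on the right only the pieces `Hⁱ(Y) ⊗ Hⁿ(X)`, `1 ≤ i ≤ dim Y`,
have to be checked) and g29-#9 (`BettiHodgeConjectureProductsMiddlePieceHomBound`: a piece `H^{2a} ⊗ H^{2b}` without exceptional Hodge classes has algebraic Hodge classes).  Sorting the pieces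
`Hⁱ(Y) ⊗ Hⁿ(X)` by parity gives two clean criteria for an ARBITRARY smooth projective `Y` with `HC(Y)` (free for `dim Y ≤ 3`):

* `n = dim X` ODD: only the pieces `Hⁱ(Y) ⊗ Hⁿ(X)` with `i` odd have even degree, and the criterion is **`Hdg(HⁱY ⊗ HⁿX) = 0` for all odd `i ≤ dim Y`** (`⟺ Hom_HS(HⁱY, HⁿX((n−i)/2)) = 0`, Lemma 11.41);
* `n = 2h` EVEN: only the pieces with `i = 2a` even occur, and the criterion is **`dim Hdg^{a+h}(H^{2a}Y ⊗ HⁿX) ≤ ρₐ(Y)·ρ_h(X)`** (`⟺ dim Hom_HS(H^{2a}Y, HⁿX(h − a)) ≤ ρₐρ_h`) for `2 ≤ 2a ≤ dim Y`.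

WHAT IS PROVED.
* §1 `n` ODD: **`BettiUniverse.hodgeConjectureFor_tensor_of_offMiddle_algebraic_right_odd`** (`⊥` form), `…_of_subsingleton_hom` (`Hom` form), `…_of_dim_le_three` (`dim Y ≤ 3`: `HC(Y)` is the tree's
  `hodgeConjectureFor_of_dim_le_three_holds`), and the curve case **`BettiUniverse.hodgeConjectureFor_curve_tensor_of_offMiddle_algebraic_odd`** (`HC(C × X) ⟸ HC(X)` and `Hdg(H¹C ⊗ HⁿX) = 0`).
* §2 `n` EVEN: **`BettiUniverse.hodgeConjectureFor_tensor_of_offMiddle_algebraic_right_even`** (piecewise count form) and `…_of_finrank_hom_le_mul` (`Hom` form), `…_of_dim_le_three`.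
* §3 SMOOTH HYPERSURFACES `X ⊂ ℙ^{n+1}_ℂ` (off-middle algebraic by Voisin II Cor. 1.24/1.25, g29-#7; `HC(X)` free for `n` odd): **`IsSmoothHypersurface.hodgeConjectureFor_tensor_left_of_odd`** (`Y` with `HC(Y)`,
  `X` of odd dimension, `Hdg(H^{odd}Y ⊗ HⁿX) = 0`), `…_of_odd_of_dim_le_three` (every curve / surface / threefold `Y`), **`IsSmoothHypersurface.hodgeConjectureFor_tensor_left_of_even`** (`X` of even
  dimension with `HC(X)`, no exceptional classes on the pieces `H^{2a}Y ⊗ HⁿX`), `…_of_even_of_dim_le_three`.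

THE PRINTS.  C. Voisin (2002) [VoisinHodgeI2002] §11.3.3 Thm. 11.38, Thm. 11.40, Lemma 11.41 and p. 287 (Künneth components of Hodge classes; Hodge classes of `Hᵏ ⊗ Hˡ` ↔ morphisms of Hodge structures;
exceptional classes = graphs of morphisms).  C. Voisin (2003) [VoisinHodgeII2003] §1.2.3 Cor. 1.24–1.25 (smooth hypersurfaces), §9.2.4 proof of Prop. 9.20, §10.2.3 proof of Prop. 10.26 (`HC` in
dimension `≤ 3`).  P. Deligne (2000/2006) [Deligne2000] §1.

THE OBJECTS (all the tree's).  `Y X C : SchemeOver ℂ`, `IsSmoothProjective`, `IsSmoothHypersurface n e X`; `hHD : exists_isReal_hodgeModel`; `Hᵏ(X) = BettiUniverse.hodge hHD hX k`, `hodgeClasses`,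
`HodgeStructure.Hom`, `tensor`, `tateTwist`, `cast`; `BettiUniverse.kunnethSummand`, `BettiUniverse.crossMap`; `bettiCohomology`, `ofRatClass`, `algebraicClasses`, `HodgeConjectureFor`.

DEVIATIONS / SCOPE.  Nothing is claimed about WHEN `Hom_HS(HⁱY, HⁿX(s))` vanishes or is small (that is the arithmetic of the particular pair); the hypotheses are exactly the absence of exceptional
Hodge classes on the relevant Künneth pieces.  No definitions.

## References
* [VoisinHodgeI2002] C. Voisin, *Hodge Theory and Complex Algebraic Geometry I* (2002) — §11.3.3 Thm. 11.38, Thm. 11.40, Lemma 11.41, p. 287.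
* [VoisinHodgeII2003] C. Voisin, *Hodge Theory and Complex Algebraic Geometry II* (2003) — §1.2.3 Cor. 1.24–1.25; §9.2.4 Prop. 9.20; §10.2.3 Prop. 10.26.
* [Deligne2000] P. Deligne, *The Hodge conjecture* (Clay problem description) — §1.

## Provenance
Lane `lit-hodgefound` (Hodge path, Track 2), prover seat `lit-hodgefound-p29` (generation 29), self-proposed row g29-#10 (g29-#7/#9 sorted by parity; low-dimensional `Y` times hypersurfaces).
-/

noncomputable section

open scoped TensorProduct
open CategoryTheory MonoidalCategory Module Finset
open Literature.AlgebraicTopology.SingularHomology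
open Literature.Geometry.Kaehler

namespace Literature.AlgebraicGeometry.HodgeTheory

open Literature.AlgebraicGeometry.Motives
open Literature.AlgebraicGeometry.Motives.HodgeStructure

variable {m n d : ℕ} {X Y C : SchemeOver ℂ}

/-! ### §1 `dim X` odd: no Hodge class on `H^{odd}(Y) ⊗ Hⁿ(X)` -/

section OddCase

variable [HodgeTensorFacts.{0, 0}]

/-- **`HC(Y × X)` for `X` off-middle algebraic of ODD dimension `n`**: if `HC(Y)`, `HC(X)`, `Hᵏ(X;ℚ) = 0` for odd `k ≠ n`, `Hdgᵖ(H^{2p}X) = H^{2p}(X;ℚ)` for all `p` with `2p ≠ n`, and the pieces `Hⁱ(Y) ⊗ Hⁿ(X)`,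
`i` odd, `i ≤ dim Y`, carry NO Hodge class, then `HC(Y × X)` (g29-#7: only the pieces `Hⁱ(Y) ⊗ Hⁿ(X)` matter; for `i` even they have odd degree). [cite: VoisinHodgeI2002, §11.3.3 Thm. 11.38–11.40, Lemma 11.41 and p. 287]
[cite: Deligne2000, §1] -/
theorem BettiUniverse.hodgeConjectureFor_tensor_of_offMiddle_algebraic_right_odd (hHD : exists_isReal_hodgeModel) (hY : IsSmoothProjective m Y) (hX : IsSmoothProjective n X)
    (hYX : IsSmoothProjective d (Y ⊗ X)) (hHCY : HodgeConjectureFor m Y) (hHCX : HodgeConjectureFor n X) (hn : Odd n)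
    (hodd : ∀ k, Odd k → k ≠ n → Module.finrank ℚ (bettiCohomology X k) = 0) (heven : ∀ p, 2 * p ≠ n → (BettiUniverse.hodge hHD hX (2 * p)).hodgeClasses p = ⊤)
    (hbot : ∀ (i c : ℕ), Odd i → i ≤ m → i + n = 2 * c → ((BettiUniverse.hodge hHD hY i).tensor (BettiUniverse.hodge hHD hX n)).hodgeClasses (c : ℤ) = ⊥) :
    HodgeConjectureFor d (Y ⊗ X) := by
  refine BettiUniverse.hodgeConjectureFor_tensor_of_offMiddle_algebraic_right hHD hY hX hYX hHCY hHCX hodd heven fun c i hin _ hi t ht ↦ ?_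
  have hio : Odd i := by
    obtain ⟨k, hk⟩ := hn
    exact Nat.odd_iff.2 (by omega)
  have ht' : t ∈ ((BettiUniverse.hodge hHD hY i).tensor (BettiUniverse.hodge hHD hX n)).hodgeClasses (c : ℤ) := by
    change t ∈ (((BettiUniverse.hodge hHD hY i).tensor (BettiUniverse.hodge hHD hX n)).cast _).hodgeClasses _ at ht
    rw [HodgeStructure.cast_hodgeClasses] at ht
    exact ht
  rw [hbot i c hio hi hin, Submodule.mem_bot] at ht'
  rw [ht', map_zero, map_zero]
  exact Submodule.zero_mem _

omit [HodgeTensorFacts.{0, 0}] in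
/-- **`Hom` form** (`dim X` odd): `HC(Y × X) ⟸ HC(Y), HC(X)` and `Hom_HS(HⁱY, HⁿX(s)) = 0` for all odd `i ≤ dim Y`, `n − 2s = i` (Lemma 11.41 and a polarization of `HⁱY`).
[cite: VoisinHodgeI2002, §11.3.3 Lemma 11.41 and §7.1.2] -/
theorem BettiUniverse.hodgeConjectureFor_tensor_of_offMiddle_algebraic_right_odd_of_subsingleton_hom (hHD : exists_isReal_hodgeModel) (hY : IsSmoothProjective m Y) (hX : IsSmoothProjective n X)
    (hYX : IsSmoothProjective d (Y ⊗ X)) (hHCY : HodgeConjectureFor m Y) (hHCX : HodgeConjectureFor n X) (hn : Odd n)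
    (hodd : ∀ k, Odd k → k ≠ n → Module.finrank ℚ (bettiCohomology X k) = 0) (heven : ∀ p, 2 * p ≠ n → (BettiUniverse.hodge hHD hX (2 * p)).hodgeClasses p = ⊤)
    (hHom : ∀ (i : ℕ) (s : ℤ) (hs : (n : ℤ) - 2 * s = i), Odd i → i ≤ m → Subsingleton (HodgeStructure.Hom (BettiUniverse.hodge hHD hY i) (((BettiUniverse.hodge hHD hX n).tateTwist s).cast hs))) :
    HodgeConjectureFor d (Y ⊗ X) := by
  haveI : HodgeTensorFacts.{0, 0} := hodgeTensorFacts_holds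
  refine BettiUniverse.hodgeConjectureFor_tensor_of_offMiddle_algebraic_right_odd hHD hY hX hYX hHCY hHCX hn hodd heven fun i c hio hi hic ↦ ?_
  have hs : (n : ℤ) - 2 * ((c : ℤ) - i) = i := by omega
  have h := (BettiUniverse.hodgeClasses_tensor_hodge_eq_bot_iff_subsingleton_hom_tateTwist hHD hY hX i n hs).2 (hHom i _ hs hio hi)
  rwa [show (i : ℤ) + ((c : ℤ) - i) = (c : ℤ) by ring] at h

/-- **`dim Y ≤ 3`** (`HC(Y)` by Lefschetz `(1,1)` and hard Lefschetz, the tree's `hodgeConjectureFor_of_dim_le_three_holds`): `HC(Y × X)` for `X` off-middle algebraic of odd dimension with `HC(X)` as soon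
as `Hdg(HⁱY ⊗ HⁿX) = 0` for the odd `i ≤ dim Y` (i.e. `i = 1` and, for threefolds, `i = 3`). [cite: VoisinHodgeI2002, §11.3.3 Lemma 11.41 and p. 287] [cite: VoisinHodgeII2003, §10.2.3 proof of Prop. 10.26] -/
theorem BettiUniverse.hodgeConjectureFor_tensor_of_offMiddle_algebraic_right_odd_of_dim_le_three (hHD : exists_isReal_hodgeModel) (hY : IsSmoothProjective m Y) (hm : m ≤ 3)
    (hX : IsSmoothProjective n X) (hYX : IsSmoothProjective d (Y ⊗ X)) (hHCX : HodgeConjectureFor n X) (hn : Odd n)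
    (hodd : ∀ k, Odd k → k ≠ n → Module.finrank ℚ (bettiCohomology X k) = 0) (heven : ∀ p, 2 * p ≠ n → (BettiUniverse.hodge hHD hX (2 * p)).hodgeClasses p = ⊤)
    (hbot : ∀ (i c : ℕ), Odd i → i ≤ m → i + n = 2 * c → ((BettiUniverse.hodge hHD hY i).tensor (BettiUniverse.hodge hHD hX n)).hodgeClasses (c : ℤ) = ⊥) :
    HodgeConjectureFor d (Y ⊗ X) :=
  BettiUniverse.hodgeConjectureFor_tensor_of_offMiddle_algebraic_right_odd hHD hY hX hYX (hodgeConjectureFor_of_dim_le_three_holds hm hY) hHCX hn hodd heven hbot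

/-- **Curves: `HC(C × X) ⟸ HC(X)` and `Hdg(H¹C ⊗ HⁿX) = 0`** for `X` off-middle algebraic of odd dimension `n` (the only piece to check is `H¹(C) ⊗ Hⁿ(X) ⊂ H^{n+1}(C × X)`; no Hodge class there iff
`Hom_HS(H¹C, HⁿX((n−1)/2)) = 0`, e.g. when the weight-one part of `HⁿX` shares no isogeny factor with `H¹C`). [cite: VoisinHodgeI2002, §11.3.3 Lemma 11.41 and p. 287] [cite: Deligne2000, §1] -/
theorem BettiUniverse.hodgeConjectureFor_curve_tensor_of_offMiddle_algebraic_odd (hHD : exists_isReal_hodgeModel) (hC : IsSmoothProjective 1 C) (hX : IsSmoothProjective n X)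
    (hCX : IsSmoothProjective d (C ⊗ X)) (hHCX : HodgeConjectureFor n X) (hn : Odd n)
    (hodd : ∀ k, Odd k → k ≠ n → Module.finrank ℚ (bettiCohomology X k) = 0) (heven : ∀ p, 2 * p ≠ n → (BettiUniverse.hodge hHD hX (2 * p)).hodgeClasses p = ⊤)
    (hbot : ∀ c : ℕ, 1 + n = 2 * c → ((BettiUniverse.hodge hHD hC 1).tensor (BettiUniverse.hodge hHD hX n)).hodgeClasses (c : ℤ) = ⊥) :
    HodgeConjectureFor d (C ⊗ X) := by
  refine BettiUniverse.hodgeConjectureFor_tensor_of_offMiddle_algebraic_right_odd_of_dim_le_three hHD hC (by norm_num) hX hCX hHCX hn hodd heven fun i c hio hi hic ↦ ?_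
  obtain rfl : i = 1 := by
    obtain ⟨k, hk⟩ := hio
    omega
  exact hbot c hic

end OddCase

/-! ### §2 `dim X = 2h` even: no exceptional Hodge class on `H^{2a}(Y) ⊗ Hⁿ(X)` -/

section EvenCase

variable [HodgeTensorFacts.{0, 0}]

/-- **`HC(Y × X)` for `X` off-middle algebraic of EVEN dimension `n = 2h`**: if `HC(Y)`, `HC(X)`, `X` has no odd cohomology, `Hdgᵖ(H^{2p}X) = H^{2p}(X;ℚ)` for `2p ≠ n`, and for every `2 ≤ 2a ≤ dim Y` the
piece `H^{2a}(Y) ⊗ Hⁿ(X)` carries no exceptional Hodge class — `dim_ℚ Hdg^{a+h}(H^{2a}Y ⊗ HⁿX) ≤ ρₐ(Y) · ρ_h(X)` — then `HC(Y × X)` (g29-#7 + g29-#9 §1; the pieces `Hⁱ(Y) ⊗ Hⁿ(X)` with `i` odd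
have odd degree). [cite: VoisinHodgeI2002, §11.3.3 Thm. 11.38–11.40, Lemma 11.41 and p. 287] [cite: VoisinHodgeII2003, §9.2.4 proof of Prop. 9.20] [cite: Deligne2000, §1] -/
theorem BettiUniverse.hodgeConjectureFor_tensor_of_offMiddle_algebraic_right_even (hHD : exists_isReal_hodgeModel) (hY : IsSmoothProjective m Y) (hX : IsSmoothProjective n X)
    (hYX : IsSmoothProjective d (Y ⊗ X)) (hHCY : HodgeConjectureFor m Y) (hHCX : HodgeConjectureFor n X) {h : ℕ} (hn : n = 2 * h)
    (hodd : ∀ k, Odd k → Module.finrank ℚ (bettiCohomology X k) = 0) (heven : ∀ p, 2 * p ≠ n → (BettiUniverse.hodge hHD hX (2 * p)).hodgeClasses p = ⊤)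
    (hle : ∀ (a c : ℕ) (hc : 2 * a + n = 2 * c), 1 ≤ a → 2 * a ≤ m →
      Module.finrank ℚ ↥((BettiUniverse.kunnethSummand hHD hY hX (2 * c) ⟨(2 * a, n), HasAntidiagonal.mem_antidiagonal.2 hc⟩).hodgeClasses c) ≤
        Module.finrank ℚ ↥((BettiUniverse.hodge hHD hY (2 * a)).hodgeClasses a) * Module.finrank ℚ ↥((BettiUniverse.hodge hHD hX n).hodgeClasses h)) :
    HodgeConjectureFor d (Y ⊗ X) := by
  subst hn
  have halgY : ∀ (p : ℕ), ∀ z ∈ (BettiUniverse.hodge hHD hY (2 * p)).hodgeClasses (p : ℤ), ofRatClass (ComplexPoints Y) (2 * p) z ∈ algebraicClasses Y p :=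
    fun p z hz ↦ hHCY.2 p _ (isRationalClass_ofRatClass _) ((BettiUniverse.mem_hodgeClasses_hodge_iff_isOfHodgeType hHD hY p z).1 hz)
  have halgX : ∀ (p : ℕ), ∀ z ∈ (BettiUniverse.hodge hHD hX (2 * p)).hodgeClasses (p : ℤ), ofRatClass (ComplexPoints X) (2 * p) z ∈ algebraicClasses X p :=
    fun p z hz ↦ hHCX.2 p _ (isRationalClass_ofRatClass _) ((BettiUniverse.mem_hodgeClasses_hodge_iff_isOfHodgeType hHD hX p z).1 hz)
  refine BettiUniverse.hodgeConjectureFor_tensor_of_offMiddle_algebraic_right hHD hY hX hYX hHCY hHCX (fun k hk _ ↦ hodd k hk) heven fun c i hin hi1 hi t ht ↦ ?_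
  obtain ⟨a, rfl⟩ : ∃ a, i = 2 * a := ⟨i / 2, by rcases Nat.even_or_odd i with ⟨k, hk⟩ | ⟨k, hk⟩ <;> omega⟩
  exact BettiUniverse.ofRatClass_crossMap_mem_algebraicClasses_of_finrank_hodgeClasses_le_mul hHD hY hX hin (halgY a) (halgX h) (hle a c hin (by omega) hi) ht

omit [HodgeTensorFacts.{0, 0}] in
/-- **`Hom` form** (`dim X = 2h` even): `HC(Y × X) ⟸ HC(Y), HC(X)` and `dim_ℚ Hom_HS(H^{2a}Y, HⁿX(s)) ≤ ρₐ(Y) · ρ_h(X)` for `2 ≤ 2a ≤ dim Y`, `n − 2s = 2a` (Lemma 11.41).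
[cite: VoisinHodgeI2002, §11.3.3 Lemma 11.41 and p. 287] [cite: VoisinHodgeII2003, §9.2.4 proof of Prop. 9.20] -/
theorem BettiUniverse.hodgeConjectureFor_tensor_of_offMiddle_algebraic_right_even_of_finrank_hom_le_mul (hHD : exists_isReal_hodgeModel) (hY : IsSmoothProjective m Y) (hX : IsSmoothProjective n X)
    (hYX : IsSmoothProjective d (Y ⊗ X)) (hHCY : HodgeConjectureFor m Y) (hHCX : HodgeConjectureFor n X) {h : ℕ} (hn : n = 2 * h)
    (hodd : ∀ k, Odd k → Module.finrank ℚ (bettiCohomology X k) = 0) (heven : ∀ p, 2 * p ≠ n → (BettiUniverse.hodge hHD hX (2 * p)).hodgeClasses p = ⊤)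
    (hle : ∀ (a : ℕ) (s : ℤ) (hs : (n : ℤ) - 2 * s = ((2 * a : ℕ) : ℤ)), 1 ≤ a → 2 * a ≤ m →
      Module.finrank ℚ (HodgeStructure.Hom (BettiUniverse.hodge hHD hY (2 * a)) (((BettiUniverse.hodge hHD hX n).tateTwist s).cast hs)) ≤
        Module.finrank ℚ ↥((BettiUniverse.hodge hHD hY (2 * a)).hodgeClasses a) * Module.finrank ℚ ↥((BettiUniverse.hodge hHD hX n).hodgeClasses h)) :
    HodgeConjectureFor d (Y ⊗ X) := by
  haveI : HodgeTensorFacts.{0, 0} := hodgeTensorFacts_holds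
  refine BettiUniverse.hodgeConjectureFor_tensor_of_offMiddle_algebraic_right_even hHD hY hX hYX hHCY hHCX hn hodd heven fun a c hc ha1 ha ↦ ?_
  subst hn
  have hs : (((2 * h : ℕ)) : ℤ) - 2 * ((h : ℤ) - a) = ((2 * a : ℕ) : ℤ) := by push_cast; ring
  have e := BettiUniverse.finrank_hodgeClasses_tensor_hodge_eq_finrank_hom_tateTwist hHD hY hX (2 * a) (2 * h) hs
  rw [show (((2 * a : ℕ)) : ℤ) + ((h : ℤ) - a) = ((c : ℕ) : ℤ) by push_cast; omega] at e
  rw [BettiUniverse.kunnethSummand, HodgeStructure.cast_hodgeClasses, e]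
  exact hle a _ hs ha1 ha

/-- **`dim Y ≤ 3`**, `dim X = 2h` even: `HC(Y × X) ⟸ HC(X)` and no exceptional Hodge class on `H²(Y) ⊗ Hⁿ(X)` — the only even `i` with `2 ≤ i ≤ 3` is `i = 2`: `dim Hdg^{h+1}(H²Y ⊗ HⁿX) ≤ ρ(Y) · ρ_h(X)`.
[cite: VoisinHodgeI2002, §11.3.3 Lemma 11.41 and p. 287] [cite: VoisinHodgeII2003, §10.2.3 proof of Prop. 10.26] -/
theorem BettiUniverse.hodgeConjectureFor_tensor_of_offMiddle_algebraic_right_even_of_dim_le_three (hHD : exists_isReal_hodgeModel) (hY : IsSmoothProjective m Y) (hm : m ≤ 3)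
    (hX : IsSmoothProjective n X) (hYX : IsSmoothProjective d (Y ⊗ X)) (hHCX : HodgeConjectureFor n X) {h : ℕ} (hn : n = 2 * h)
    (hodd : ∀ k, Odd k → Module.finrank ℚ (bettiCohomology X k) = 0) (heven : ∀ p, 2 * p ≠ n → (BettiUniverse.hodge hHD hX (2 * p)).hodgeClasses p = ⊤)
    (hle : ∀ (c : ℕ) (hc : 2 * 1 + n = 2 * c), 2 ≤ m →
      Module.finrank ℚ ↥((BettiUniverse.kunnethSummand hHD hY hX (2 * c) ⟨(2 * 1, n), HasAntidiagonal.mem_antidiagonal.2 hc⟩).hodgeClasses c) ≤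
        Module.finrank ℚ ↥((BettiUniverse.hodge hHD hY (2 * 1)).hodgeClasses 1) * Module.finrank ℚ ↥((BettiUniverse.hodge hHD hX n).hodgeClasses h)) :
    HodgeConjectureFor d (Y ⊗ X) := by
  refine BettiUniverse.hodgeConjectureFor_tensor_of_offMiddle_algebraic_right_even hHD hY hX hYX (hodgeConjectureFor_of_dim_le_three_holds hm hY) hHCX hn hodd heven fun a c hc ha1 ha ↦ ?_
  obtain rfl : a = 1 := by omega
  exact hle c hc (by omega)

end EvenCase

end Literature.AlgebraicGeometry.HodgeTheory

/-! ### §3 Times a smooth hypersurface -/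

namespace Literature.AlgebraicGeometry.Motives.IsSmoothHypersurface

open Literature.AlgebraicGeometry.Motives
open Literature.AlgebraicGeometry.HodgeTheory

variable {m n e : ℕ} {X Y : SchemeOver ℂ}

/-- **`HC(Y × X)` for `X ⊂ ℙ^{n+1}_ℂ` a smooth hypersurface of ODD dimension and `Y` any smooth projective variety with `HC(Y)` such that `Hdg(HⁱY ⊗ HⁿX) = 0` for all odd `i ≤ dim Y`** (`X` is off-middle
algebraic with `HC(X)`, Cor. 1.24/1.25). [cite: VoisinHodgeII2003, §1.2.3 Cor. 1.24 and Cor. 1.25] [cite: VoisinHodgeI2002, §11.3.3 Lemma 11.41 and p. 287] -/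
theorem hodgeConjectureFor_tensor_left_of_odd [HodgeTensorFacts.{0, 0}] (hX : IsSmoothHypersurface n e X) (hHD : exists_isReal_hodgeModel) (hn : Odd n) (hY : IsSmoothProjective m Y)
    (hHCY : HodgeConjectureFor m Y)
    (hbot : ∀ (i c : ℕ), Odd i → i ≤ m → i + n = 2 * c → ((BettiUniverse.hodge hHD hY i).tensor (BettiUniverse.hodge hHD hX.1 n)).hodgeClasses (c : ℤ) = ⊥) :
    HodgeConjectureFor (m + n) (Y ⊗ X) :=
  BettiUniverse.hodgeConjectureFor_tensor_of_offMiddle_algebraic_right_odd hHD hY hX.1 (hY.tensor_holds hX.1) hHCY (hX.hodgeConjectureFor_of_odd hHD hn) hn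
    (fun _ hk hkn ↦ hX.finrank_bettiCohomology_eq_zero_of_odd hk hkn) (fun _ hp ↦ hX.hodgeClasses_hodge_eq_top_of_two_mul_ne hHD hX.1 hp) hbot

/-- `Hom` form: **`HC(Y × X)`** for `X` a smooth hypersurface of odd dimension, `HC(Y)`, and `Hom_HS(HⁱY, HⁿX(s)) = 0` for all odd `i ≤ dim Y` (`n − 2s = i`).
[cite: VoisinHodgeII2003, §1.2.3 Cor. 1.24 and Cor. 1.25] [cite: VoisinHodgeI2002, §11.3.3 Lemma 11.41 and §7.1.2] -/
theorem hodgeConjectureFor_tensor_left_of_odd_of_subsingleton_hom (hX : IsSmoothHypersurface n e X) (hHD : exists_isReal_hodgeModel) (hn : Odd n) (hY : IsSmoothProjective m Y)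
    (hHCY : HodgeConjectureFor m Y)
    (hHom : ∀ (i : ℕ) (s : ℤ) (hs : (n : ℤ) - 2 * s = i), Odd i → i ≤ m → Subsingleton (HodgeStructure.Hom (BettiUniverse.hodge hHD hY i) (((BettiUniverse.hodge hHD hX.1 n).tateTwist s).cast hs))) :
    HodgeConjectureFor (m + n) (Y ⊗ X) :=
  BettiUniverse.hodgeConjectureFor_tensor_of_offMiddle_algebraic_right_odd_of_subsingleton_hom hHD hY hX.1 (hY.tensor_holds hX.1) hHCY (hX.hodgeConjectureFor_of_odd hHD hn) hn
    (fun _ hk hkn ↦ hX.finrank_bettiCohomology_eq_zero_of_odd hk hkn) (fun _ hp ↦ hX.hodgeClasses_hodge_eq_top_of_two_mul_ne hHD hX.1 hp) hHom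

/-- **Every curve, surface or threefold `Y` times a smooth hypersurface `X` of odd dimension satisfies `HC` as soon as `Hdg(HⁱY ⊗ HⁿX) = 0` for the odd `i ≤ dim Y`** — UNCONDITIONALLY otherwise
(`HC(Y)` for `dim Y ≤ 3`, `HC(X)` by Lefschetz). [cite: VoisinHodgeII2003, §1.2.3 Cor. 1.24–1.25 and §10.2.3 proof of Prop. 10.26] [cite: VoisinHodgeI2002, §11.3.3 Lemma 11.41 and p. 287] -/
theorem hodgeConjectureFor_tensor_left_of_odd_of_dim_le_three [HodgeTensorFacts.{0, 0}] (hX : IsSmoothHypersurface n e X) (hHD : exists_isReal_hodgeModel) (hn : Odd n)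
    (hY : IsSmoothProjective m Y) (hm : m ≤ 3)
    (hbot : ∀ (i c : ℕ), Odd i → i ≤ m → i + n = 2 * c → ((BettiUniverse.hodge hHD hY i).tensor (BettiUniverse.hodge hHD hX.1 n)).hodgeClasses (c : ℤ) = ⊥) :
    HodgeConjectureFor (m + n) (Y ⊗ X) :=
  hX.hodgeConjectureFor_tensor_left_of_odd hHD hn hY (hodgeConjectureFor_of_dim_le_three_holds hm hY) hbot

/-- **`HC(Y × X)` for `X ⊂ ℙ^{2h+1}_ℂ` a smooth hypersurface of EVEN dimension `n = 2h` with `HC(X)` and `Y` any smooth projective variety with `HC(Y)` such that the pieces `H^{2a}(Y) ⊗ Hⁿ(X)`,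
`2 ≤ 2a ≤ dim Y`, carry no exceptional Hodge class** (`dim Hom_HS(H^{2a}Y, HⁿX(h − a)) ≤ ρₐ(Y) · ρ_h(X)`). [cite: VoisinHodgeII2003, §1.2.3 Cor. 1.24 and Cor. 1.25] [cite: VoisinHodgeI2002, §11.3.3 Lemma 11.41 and p. 287] -/
theorem hodgeConjectureFor_tensor_left_of_even_of_finrank_hom_le_mul (hX : IsSmoothHypersurface n e X) (hHD : exists_isReal_hodgeModel) {h : ℕ} (hn : n = 2 * h) (hHCX : HodgeConjectureFor n X)
    (hY : IsSmoothProjective m Y) (hHCY : HodgeConjectureFor m Y)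
    (hle : ∀ (a : ℕ) (s : ℤ) (hs : (n : ℤ) - 2 * s = ((2 * a : ℕ) : ℤ)), 1 ≤ a → 2 * a ≤ m →
      Module.finrank ℚ (HodgeStructure.Hom (BettiUniverse.hodge hHD hY (2 * a)) (((BettiUniverse.hodge hHD hX.1 n).tateTwist s).cast hs)) ≤
        Module.finrank ℚ ↥((BettiUniverse.hodge hHD hY (2 * a)).hodgeClasses a) * Module.finrank ℚ ↥((BettiUniverse.hodge hHD hX.1 n).hodgeClasses h)) :
    HodgeConjectureFor (m + n) (Y ⊗ X) :=
  BettiUniverse.hodgeConjectureFor_tensor_of_offMiddle_algebraic_right_even_of_finrank_hom_le_mul hHD hY hX.1 (hY.tensor_holds hX.1) hHCY hHCX hn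
    (fun _ hk ↦ hX.finrank_bettiCohomology_eq_zero_of_odd hk fun hkn ↦ (Nat.not_even_iff_odd.2 hk) ⟨h, by omega⟩) (fun _ hp ↦ hX.hodgeClasses_hodge_eq_top_of_two_mul_ne hHD hX.1 hp) hle

/-- **Every curve, surface or threefold `Y` times a smooth hypersurface `X` of even dimension `2h` with `HC(X)` satisfies `HC` as soon as `dim Hom_HS(H²Y, HⁿX(h − 1)) ≤ ρ(Y) · ρ_h(X)`** (the only
even `i` with `2 ≤ i ≤ 3`). [cite: VoisinHodgeII2003, §1.2.3 Cor. 1.24–1.25 and §10.2.3 proof of Prop. 10.26] [cite: VoisinHodgeI2002, §11.3.3 Lemma 11.41 and p. 287] -/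
theorem hodgeConjectureFor_tensor_left_of_even_of_dim_le_three (hX : IsSmoothHypersurface n e X) (hHD : exists_isReal_hodgeModel) {h : ℕ} (hn : n = 2 * h) (hHCX : HodgeConjectureFor n X)
    (hY : IsSmoothProjective m Y) (hm : m ≤ 3)
    (hle : ∀ (s : ℤ) (hs : (n : ℤ) - 2 * s = ((2 * 1 : ℕ) : ℤ)), 2 ≤ m →
      Module.finrank ℚ (HodgeStructure.Hom (BettiUniverse.hodge hHD hY (2 * 1)) (((BettiUniverse.hodge hHD hX.1 n).tateTwist s).cast hs)) ≤
        Module.finrank ℚ ↥((BettiUniverse.hodge hHD hY (2 * 1)).hodgeClasses 1) * Module.finrank ℚ ↥((BettiUniverse.hodge hHD hX.1 n).hodgeClasses h)) :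
    HodgeConjectureFor (m + n) (Y ⊗ X) := by
  refine hX.hodgeConjectureFor_tensor_left_of_even_of_finrank_hom_le_mul hHD hn hHCX hY (hodgeConjectureFor_of_dim_le_three_holds hm hY) fun a s hs ha1 ha ↦ ?_
  obtain rfl : a = 1 := by omega
  exact hle s hs (by omega)

end Literature.AlgebraicGeometry.Motives.IsSmoothHypersurface

end
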